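import Mathlib.Data.List.GetD
import Summits.Ventures.CertifiedArithmetic.LowPrec.Accumulate

/-!
# Tie chains (I): stationarity of the sequential accumulator; the FP4 product alphabet

HONEST FRAMING (venture CertifiedArithmetic / cell `pub-lowprec`): certified error envelopes and
provably optimal rounding/accumulation schemes for low-precision formats under stated cost models;
every table by two implementations; no hardware or vendor claims.

Setting (bundle `papers/Ventures/CertifiedArithmetic/lowprec/`, `paper/gemm.tex`): an inner
product of length `n` of `E2M1` (FP4) vectors, products formed EXACTLY (the product alphabet
`Π(E2M1,E2M1)` has 37 values, all in `¼ℤ ∩ [-36, 36]`, hence representable in `bfloat16` and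
`binary16`), accumulated sequentially (`MiniFloat.seqSum`: `ŝ₀ = fl(p₀)`, `ŝₖ₊₁ = fl(ŝₖ + pₖ₊₁)`)
under round-to-nearest-even. The worst case `W(n) = max |ŝ - s| / Σ|pᵢ|` over `Πⁿ` is computed
row by row by two implementations (certificate files of the bundle). The lower-bound families of
`gemm.tex` (Props. `p:sandwich`, `p:limit`, `p:fp16`) are all of one shape — a fixed prefix, then
a constant letter `c` that the accumulator absorbs at a TIE (`fl(v + c) = v`, even significand
kept) — and this file provides the all-length engine for them:

* `seqSum_stationary`: once `ŝₘ = v` with `fl(v + c) = v` and all later letters equal `c`, the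
  accumulator never moves again; `tieChain_spec` adds the exact sum `S + (k-m)c` and the mass
  `Λ + (k-m)|c|`; `tieChain_inRange` the finite-range side condition for every length;
* `piE2M1`: the 37-letter product alphabet, with `mul_mem_piE2M1` / `exists_mul_eq_of_mem_piE2M1`
  (the list IS the set of `E2M1 · E2M1` products) and `W(2) = 0` for `E2M1² → bfloat16`
  (`roundNE_add_of_mem_piE2M1`, `seqSum_one_exact_E2M1_BFloat16`: every `p₁ + p₂` is a value).

The families themselves (five in `bfloat16`, one in `binary16`) and their exact ratios for every
`n` are in `GemmTieChainFamilies.lean`. Finite prefix facts are `decide +kernel` computations on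
the executable rounding model; the all-`n` statements follow by the stationarity induction.
-/

namespace Literature.ComputerArithmetic.FloatingPoint

namespace MiniFloat

open Finset

variable {α : Format}

/-! ### Stationarity of the sequential accumulator -/

/-- Unfolding equation of the accumulator. [folklore] -/
theorem seqSum_succ' (x : ℕ → ℚ) (k : ℕ) :
    seqSum α x (k + 1) = roundNE α ((seqSum α x k).toRat + x (k + 1)) := rfl

/-- STATIONARITY: if the accumulator holds `v` after the prefix `x 0 … x m`, every later letter is
`c`, and `fl(v + c) = v` (e.g. `v + c` is the midpoint of `v` and a neighbour and `v` has the even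
significand), then `ŝₖ = v` for every `k ≥ m`. [folklore] -/
theorem seqSum_stationary (x : ℕ → ℚ) (m : ℕ) (c v : ℚ) (hx : ∀ k, m < k → x k = c)
    (hm : (seqSum α x m).toRat = v) (hfix : (roundNE α (v + c)).toRat = v) :
    ∀ k, m ≤ k → (seqSum α x k).toRat = v := by
  intro k hk
  induction k with
  | zero =>
      obtain rfl : m = 0 := Nat.le_zero.mp hk
      exact hm
  | succ k ih =>
      rcases Nat.lt_or_eq_of_le hk with h | h
      · rw [seqSum_succ', ih (Nat.lt_succ_iff.mp h), hx (k + 1) h, hfix]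
      · rw [← h]; exact hm

/-- Exact partial sums of prefix-then-constant data: `Σ_{i≤k} xᵢ = S + (k - m)·c`. [folklore] -/
theorem sum_range_stationary (x : ℕ → ℚ) (m : ℕ) (c S : ℚ) (hx : ∀ k, m < k → x k = c)
    (h0 : ∑ i ∈ range (m + 1), x i = S) :
    ∀ k, m ≤ k → ∑ i ∈ range (k + 1), x i = S + ((k : ℚ) - m) * c := by
  intro k hk
  induction k with
  | zero =>
      obtain rfl : m = 0 := Nat.le_zero.mp hk
      rw [h0]; simp
  | succ k ih =>
      rcases Nat.lt_or_eq_of_le hk with h | h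
      · rw [sum_range_succ, ih (Nat.lt_succ_iff.mp h), hx (k + 1) h]
        push_cast; ring
      · rw [← h, h0]; simp

/-- THE TIE-CHAIN TEMPLATE: prefix `x 0 … x m` with accumulator `v`, exact sum `S`, mass `Λ`;
constant tail `c` with `fl(v + c) = v`. Then for every `k ≥ m`:
`ŝₖ = v`, `Σ_{i≤k} xᵢ = S + (k-m)c`, `Σ_{i≤k} |xᵢ| = Λ + (k-m)|c|`. [folklore] -/
theorem tieChain_spec (x : ℕ → ℚ) (m : ℕ) (c v S Λ : ℚ) (hx : ∀ k, m < k → x k = c)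
    (hm : (seqSum α x m).toRat = v) (hfix : (roundNE α (v + c)).toRat = v)
    (hS : ∑ i ∈ range (m + 1), x i = S) (hΛ : ∑ i ∈ range (m + 1), |x i| = Λ) :
    ∀ k, m ≤ k → (seqSum α x k).toRat = v ∧ ∑ i ∈ range (k + 1), x i = S + ((k : ℚ) - m) * c ∧
      ∑ i ∈ range (k + 1), |x i| = Λ + ((k : ℚ) - m) * |c| := fun k hk =>
  ⟨seqSum_stationary x m c v hx hm hfix k hk, sum_range_stationary x m c S hx hS k hk,
    sum_range_stationary (fun i => |x i|) m |c| Λ (fun k h => by simp [hx k h]) hΛ k hk⟩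

/-- Range side condition of a tie chain: if the prefix stays in range and `|v + c| ≤ maxRat`, no
step ever leaves the finite range (`InRange` for every length). [folklore] -/
theorem tieChain_inRange (x : ℕ → ℚ) (m : ℕ) (c v : ℚ) (hx : ∀ k, m < k → x k = c)
    (hm : (seqSum α x m).toRat = v) (hfix : (roundNE α (v + c)).toRat = v)
    (h0 : InRange α x m) (hv : |v + c| ≤ α.maxRat) : ∀ k, InRange α x k := by
  intro k
  refine ⟨h0.1, fun j hj => ?_⟩
  by_cases hjm : j < m
  · exact h0.2 j hjm
  · rw [seqSum_stationary x m c v hx hm hfix j (not_lt.mp hjm), hx (j + 1) (by omega)]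
    exact hv

/-- Letters of prefix-then-constant data given by `List.getD`. [folklore] -/
theorem getD_tail (pre : List ℚ) (c : ℚ) {m : ℕ} (hm : pre.length = m + 1) :
    ∀ k, m < k → pre.getD k c = c :=
  fun k hk => List.getD_eq_default _ _ (by omega)

/-- A `getD` letter is a prefix letter or the tail constant. [folklore] -/
theorem getD_mem_or (pre : List ℚ) (c : ℚ) (k : ℕ) : pre.getD k c ∈ pre ∨ pre.getD k c = c := by
  rw [List.getD_eq_getElem?_getD]
  cases h : pre[k]? with
  | none => simp
  | some a => exact Or.inl (by simpa using List.mem_of_getElem? h)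

/-! ### The product alphabet `Π(E2M1, E2M1)` and the case `n = 2` -/

/-- The 37 values `{a·b : a, b ∈ E2M1}` = `{0, ±¼, ±½, ±¾, ±1, ±3/2, ±2, ±9/4, ±3, ±4, ±9/2, ±6, ±8,
±9, ±12, ±16, ±18, ±24, ±36}` (pairwise products of the `E2M1` value set `±{0, ½, 1, 3/2, 2, 3, 4, 6}`
[RouhaniEtAl2023MX, Table 1]). [folklore] -/
def piE2M1 : List ℚ :=
  [0, 1/4, -1/4, 1/2, -1/2, 3/4, -3/4, 1, -1, 3/2, -3/2, 2, -2, 9/4, -9/4, 3, -3, 4, -4, 9/2, -9/2,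
   6, -6, 8, -8, 9, -9, 12, -12, 16, -16, 18, -18, 24, -24, 36, -36]

/-- Every `E2M1 · E2M1` product is a letter of `piE2M1`. [folklore] -/
theorem mul_mem_piE2M1 (a b : MiniFloat Format.E2M1) : a.toRat * b.toRat ∈ piE2M1 :=
  of_decide_eq_true (forall₂_of_all_all (P := fun a b => decide (a.toRat * b.toRat ∈ piE2M1))
    (by decide +kernel) a b)

/-- Conversely every letter of `piE2M1` is an `E2M1 · E2M1` product. [folklore] -/
theorem exists_mul_eq_of_mem_piE2M1 :
    ∀ p ∈ piE2M1, ∃ a b : MiniFloat Format.E2M1, a.toRat * b.toRat = p := by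
  have h : (piE2M1.all fun p => (all Format.E2M1).any fun a => (all Format.E2M1).any fun b =>
      decide (a.toRat * b.toRat = p)) = true := by decide +kernel
  intro p hp
  have hp' := List.all_eq_true.mp h p hp
  simp only [List.any_eq_true, decide_eq_true_eq] at hp'
  obtain ⟨a, -, b, -, hab⟩ := hp'
  exact ⟨a, b, hab⟩

/-- `W(2) = 0` for `E2M1² → bfloat16`: the sum of ANY two letters of `Π(E2M1,E2M1)` is a `bfloat16`
value (`Π ⊂ ¼ℤ ∩ [-36,36]`: below `64` the sum has at most 8 significant bits, and `|p+q| ≥ 64`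
forces `p = q = ±36`, sum `±72`). [folklore] -/
theorem roundNE_add_of_mem_piE2M1 :
    ∀ p ∈ piE2M1, ∀ q ∈ piE2M1, (roundNE Format.BFloat16 (p + q)).toRat = p + q := by
  have h : (piE2M1.all fun p => piE2M1.all fun q =>
      decide ((roundNE Format.BFloat16 (p + q)).toRat = p + q)) = true := by decide +kernel
  intro p hp q hq
  exact of_decide_eq_true (List.all_eq_true.mp (List.all_eq_true.mp h p hp) q hq)

/-- Each letter of `Π(E2M1,E2M1)` is itself a `bfloat16` value. [folklore] -/
theorem roundNE_of_mem_piE2M1 : ∀ p ∈ piE2M1, (roundNE Format.BFloat16 p).toRat = p :=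
  fun p hp => by simpa using roundNE_add_of_mem_piE2M1 p hp 0 (by decide)

/-- `W(2) = 0`, accumulator form: for all FP4 data `a b c d`, the length-2 inner product
`fl(fl(a·b) + c·d)` in `bfloat16` is exact. [folklore] -/
theorem seqSum_one_exact_E2M1_BFloat16 (a b c d : MiniFloat Format.E2M1) :
    (seqSum Format.BFloat16 (fun i => if i = 0 then a.toRat * b.toRat else c.toRat * d.toRat) 1).toRat
      = a.toRat * b.toRat + c.toRat * d.toRat := by
  have h1 := roundNE_of_mem_piE2M1 _ (mul_mem_piE2M1 a b)
  have h2 := roundNE_add_of_mem_piE2M1 _ (mul_mem_piE2M1 a b) _ (mul_mem_piE2M1 c d)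
  show (roundNE _ ((roundNE _ (if 0 = 0 then _ else _)).toRat + if 1 = 0 then _ else _)).toRat = _
  simp only [if_true, one_ne_zero, if_false]
  rw [h1, h2]

end MiniFloat

end Literature.ComputerArithmetic.FloatingPoint
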